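import Mathlib
import Summits.NavierStokesRegularity.NavierStokesRegularity.Theorems.FilamentSkeletonRssDefectColumnGateQuasimodePrelim

/-!
# Route `FilamentSkeletonRss` · crux `TransverseReduction1AG` (stmt-NavierStokesRegularity-27853) · line `defect_column_gate_1AG` —
# THE FAR-FIELD QUASIMODE: the pointwise estimate `⟨ξ⟩⁴·|colForceVort B₀ 0 gam Rc e₃ W_L| ≤ K(Rc)/L`

Helper file (`--supports stmt-NavierStokesRegularity-27853 --as helper`; LEAD of 27853, lane ns-filament-21221-p1 g10).  The analytic heart of the owed
construction `FarFieldQuasimodes1A` (memo S2A-FALSE-FARFIELD-27853-g10.md §3): after the exact Hermite cancellation `(gam + 4b₁)p₂ + λ₂yp₃ + p₄ = 0`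
(`s = 5gam/2`), the closed form `colForceVort_farW` consists of the `1/L` dilation commutator, `O(y₀⁻¹)`-decaying profile terms and `O(Rc/y₀)` column terms;
each is bounded in the weight `(1 + y₀² + y₁²)²` by an explicit constant times `1/L` for `L ≥ 1`.
HONEST FRAMING: real analysis on an explicit MODEL operator; MODEL rung, negative side; nothing here bears on Navier–Stokes regularity.
-/

set_option linter.dupNamespace false

noncomputable section

namespace Summit.NavierStokesRegularity.NavierStokesRegularity.Theorems.DefectColumnGate

open scoped BigOperators Topology InnerProductSpace ContDiff
open Set Function Filter
open Literature.Analysis.FluidPDE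
open Summit.NavierStokesRegularity.NavierStokesRegularity.Theorems.KelvinGate

set_option maxHeartbeats 4000000 in
/-- **THE POINTWISE ESTIMATE.**  For every `Rc ≥ 0` there is `K ≥ 0` such that for all `L ≥ 1` and all `y`:
`(secWt e₃ y)²·‖colForceVort B₀ 0 gam Rc e₃ W_L (y)‖ ≤ K/L`.  (One long explicit computation: the heartbeat
budget is raised for this declaration only.) -/
theorem quasimode_estimate {Rc : ℝ} (hRc : 0 ≤ Rc) :
    ∃ K : ℝ, 0 ≤ K ∧ ∀ L : ℝ, 1 ≤ L → ∀ y : EuclideanSpace ℝ (Fin 3),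
      secWt (EuclideanSpace.single 2 1) y ^ 2 * ‖colForceVort waistB0 0 (8/5 - 3/2 : ℝ) Rc (EuclideanSpace.single 2 1) (farW L) y‖ ≤ K / L := by
  obtain ⟨M0, hM0⟩ := exists_bound_farProfile 0
  obtain ⟨M1, hM1⟩ := exists_bound_farProfile 1
  obtain ⟨M2, hM2⟩ := exists_bound_farProfile 2
  obtain ⟨M3, hM3⟩ := exists_bound_farProfile 3
  obtain ⟨M4, hM4⟩ := exists_bound_farProfile 4
  obtain ⟨Md, hMd⟩ := exists_bound_iteratedDeriv_bump12 1
  have hMd' : ∀ t, |deriv bump12 t| ≤ Md := fun t => by rw [← iteratedDeriv_one]; exact hMd t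
  have hM0p : 0 ≤ M0 := le_trans (by positivity) (hM0 1 le_rfl 0)
  have hM1p : 0 ≤ M1 := le_trans (by positivity) (hM1 1 le_rfl 0)
  have hM2p : 0 ≤ M2 := le_trans (by positivity) (hM2 1 le_rfl 0)
  have hM3p : 0 ≤ M3 := le_trans (by positivity) (hM3 1 le_rfl 0)
  have hM4p : 0 ≤ M4 := le_trans (by positivity) (hM4 1 le_rfl 0)
  have hMdp : 0 ≤ Md := le_trans (abs_nonneg _) (hMd' 0)
  have hCE := CE_nonneg
  have hlam : (0:ℝ) < lamW := lamW_pos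
  -- the Gaussian-vs-polynomial constant for the column's own Gaussian `e^{−gam x²/4} = gaussE (gam/2)`
  set CG : ℝ := 120 * (2 / ((8/5 - 3/2 : ℝ) / 2)) ^ 5 with hCG
  have hCGp : 0 ≤ CG := by rw [hCG]; positivity
  -- the constant
  refine ⟨(1/5) * (4 * Md) * ((|(-lamW)| + |(0:ℝ)| + |lamW ^ 2| + |(0:ℝ)|) * CE)
      + (4 * M2) * ((|(8/5 - 3/2 : ℝ) - 2 * lamW| + |(0:ℝ)| + |(-(3/10) * lamW + 2 * lamW ^ 2)| + |(0:ℝ)|) * CE)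
      + (1/5) * (4 * M3) * ((|(1:ℝ)| + |(0:ℝ)| + |(0:ℝ)| + |(0:ℝ)|) * CE)
      + (4 * M4) * ((|(1:ℝ)| + |(0:ℝ)| + |(0:ℝ)| + |(0:ℝ)|) * CE)
      + Rc * (4 * M3) * ((|(0:ℝ)| + |(1:ℝ)| + |(0:ℝ)| + |(0:ℝ)|) * CE)
      + Rc * (4 * M1) * ((|(0:ℝ)| + |(-lamW)| + |(0:ℝ)| + |lamW ^ 2|) * CE)
      + Rc * (4 * M2) * ((|(0:ℝ)| + |(-lamW)| + |(0:ℝ)| + |(0:ℝ)|) * CE)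
      + Rc * (4 * M0) * ((|(0:ℝ)| + |(3 * lamW ^ 2)| + |(0:ℝ)| + |(-(lamW ^ 3))|) * CE)
      + Rc * (4 * M0 * CG) * ((|(0:ℝ)| + |(-lamW)| + |(0:ℝ)| + |(0:ℝ)|) * CE)
      + Rc * (4 * M1) * ((|(0:ℝ)| + |(1:ℝ)| + |(0:ℝ)| + |(0:ℝ)|) * CE), by positivity, ?_⟩
  intro L hL y
  have hL0 : 0 < L := by linarith
  rw [colForceVort_farW hL0 Rc y, norm_smul, Real.norm_eq_abs, show ‖(EuclideanSpace.single (2 : Fin 3) (1:ℝ))‖ = 1 by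
    rw [EuclideanSpace.norm_eq]; simp, mul_one, secWt_e3]
  set x := y 0 with hxdef
  set v := y 1 with hvdef
  have hwx0 : 0 ≤ (1 + x ^ 2) ^ 2 := by positivity
  have hwy0 : 0 ≤ (1 + v ^ 2) ^ 2 := by positivity
  have hwt : (1 + x ^ 2 + v ^ 2) ^ 2 ≤ (1 + x ^ 2) ^ 2 * (1 + v ^ 2) ^ 2 := weight_split (sq_nonneg _) (sq_nonneg _)
  have hKdiv : ∀ {a K' : ℝ}, a ≤ K' * (1 / L) → a ≤ K' / L := fun h => by rwa [← div_eq_mul_one_div] at h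
  by_cases hx : |x| ≤ Real.exp L
  · -- inside `|x| ≤ e^L` every profile vanishes: the operator is zero there
    have h0 : farProfile L 0 x = 0 := farProfile_eq_zero_of_abs_le hL0 0 hx
    have h1 : farProfile L 1 x = 0 := farProfile_eq_zero_of_abs_le hL0 1 hx
    have h2 : farProfile L 2 x = 0 := farProfile_eq_zero_of_abs_le hL0 2 hx
    have h3 : farProfile L 3 x = 0 := farProfile_eq_zero_of_abs_le hL0 3 hx
    have h4 : farProfile L 4 x = 0 := farProfile_eq_zero_of_abs_le hL0 4 hx
    simp only [h0, h1, h2, h3, h4, mul_zero, zero_mul, add_zero, sub_zero, zero_add, abs_zero]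
    positivity
  · rw [not_le] at hx
    have hx1 : 1 ≤ |x| := le_trans (Real.one_le_exp hL0.le) hx.le
    have hx0 : x ≠ 0 := abs_pos.1 (lt_of_lt_of_le one_pos hx1)
    have heL : Real.exp (-L) ≤ 1 / L := exp_neg_le_inv hL
    -- abbreviations
    set F0 := farProfile L 0 x with hF0
    set F1 := farProfile L 1 x with hF1
    set F2 := farProfile L 2 x with hF2
    set F3 := farProfile L 3 x with hF3
    set F4 := farProfile L 4 x with hF4
    set E := gaussE lamW v with hEdef
    set A := deriv bump12 (Real.log x / L) / L * (x ^ 4)⁻¹ with hAdef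
    set cφ := (8/5 - 3/2 : ℝ) * Rc / (8 * Real.pi) * burgersPhi ((8/5 - 3/2) * (x ^ 2 + v ^ 2) / 4) with hcφ
    set ζ := (8/5 - 3/2 : ℝ) * Rc / (4 * Real.pi) * Real.exp (-((8/5 - 3/2) * (x ^ 2 + v ^ 2) / 4)) with hζ
    have hEpos : 0 < E := gaussE_pos lamW v
    -- Euler relation and Hermite cancellation ⇒ reduced form of `E·Q` as a sum of ten terms
    have hEuler : x * F1 = A - 4 * F0 := euler_farProfile L x
    have hHerm := hermite_cancel v
    set T1 := (-(1/5) : ℝ) * A * ((-lamW + 0 * v + lamW ^ 2 * v ^ 2 + 0 * v ^ 3) * E) with hT1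
    set T2 := (1 : ℝ) * F2 * ((((8/5 - 3/2 : ℝ) - 2 * lamW) + 0 * v + (-(3/10) * lamW + 2 * lamW ^ 2) * v ^ 2 + 0 * v ^ 3) * E) with hT2
    set T3 := (-(1/5) : ℝ) * (x * F3) * ((1 + 0 * v + 0 * v ^ 2 + 0 * v ^ 3) * E) with hT3
    set T4 := (1 : ℝ) * F4 * ((1 + 0 * v + 0 * v ^ 2 + 0 * v ^ 3) * E) with hT4
    set T5 := cφ * F3 * ((0 + 1 * v + 0 * v ^ 2 + 0 * v ^ 3) * E) with hT5
    set T6 := cφ * F1 * ((0 + (-lamW) * v + 0 * v ^ 2 + lamW ^ 2 * v ^ 3) * E) with hT6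
    set T7 := (-cφ) * (x * F2) * ((0 + (-lamW) * v + 0 * v ^ 2 + 0 * v ^ 3) * E) with hT7
    set T8 := (-(cφ * x ^ 2)) * (F0 / x) * ((0 + 3 * lamW ^ 2 * v + 0 * v ^ 2 + (-(lamW ^ 3)) * v ^ 3) * E) with hT8
    set T9 := (-((8/5 - 3/2 : ℝ) / 2 * ζ)) * (x * F0) * ((0 + (-lamW) * v + 0 * v ^ 2 + 0 * v ^ 3) * E) with hT9
    set T10 := ((8/5 - 3/2 : ℝ) / 2 * ζ) * F1 * ((0 + 1 * v + 0 * v ^ 2 + 0 * v ^ 3) * E) with hT10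
    have hsum : E * ((8/5 - 3/2) * (F2 + F0 * (lamW ^ 2 * v ^ 2 - lamW))
          - 1/5 * x * (F3 + F1 * (lamW ^ 2 * v ^ 2 - lamW))
          - (-(3/10)) * v * (F2 * (-(lamW * v)) + F0 * (-(lamW ^ 3 * v ^ 3) + 3 * lamW ^ 2 * v))
          + (F4 + 2 * (F2 * (lamW ^ 2 * v ^ 2 - lamW)) + F0 * (lamW ^ 4 * v ^ 4 - 6 * lamW ^ 3 * v ^ 2 + 3 * lamW ^ 2))
          + cφ * (v * (F3 + F1 * (lamW ^ 2 * v ^ 2 - lamW)) - x * (F2 * (-(lamW * v)) + F0 * (-(lamW ^ 3 * v ^ 3) + 3 * lamW ^ 2 * v)))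
          - (8/5 - 3/2) / 2 * ζ * (x * (F0 * (-(lamW * v))) - v * F1))
        = T1 + T2 + T3 + T4 + T5 + T6 + T7 + T8 + T9 + T10 := by
      have hx2 : x ^ 2 * (F0 / x) = x * F0 := by field_simp
      rw [hT1, hT2, hT3, hT4, hT5, hT6, hT7, hT8, hT9, hT10]
      have e8 : (-(cφ * x ^ 2)) * (F0 / x) = -(cφ * (x * F0)) := by rw [← hx2]; ring
      rw [e8]
      linear_combination (-(1/5) * (lamW ^ 2 * v ^ 2 - lamW) * E) * hEuler + (F0 * E) * hHerm
    rw [hsum]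
    -- triangle inequality
    have htri : |T1 + T2 + T3 + T4 + T5 + T6 + T7 + T8 + T9 + T10| ≤
        |T1| + |T2| + |T3| + |T4| + |T5| + |T6| + |T7| + |T8| + |T9| + |T10| := by
      have a2 := abs_add_le T1 T2
      have a3 := (abs_add_le (T1 + T2) T3).trans (add_le_add a2 le_rfl)
      have a4 := (abs_add_le (T1 + T2 + T3) T4).trans (add_le_add a3 le_rfl)
      have a5 := (abs_add_le (T1 + T2 + T3 + T4) T5).trans (add_le_add a4 le_rfl)
      have a6 := (abs_add_le (T1 + T2 + T3 + T4 + T5) T6).trans (add_le_add a5 le_rfl)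
      have a7 := (abs_add_le (T1 + T2 + T3 + T4 + T5 + T6) T7).trans (add_le_add a6 le_rfl)
      have a8 := (abs_add_le (T1 + T2 + T3 + T4 + T5 + T6 + T7) T8).trans (add_le_add a7 le_rfl)
      have a9 := (abs_add_le (T1 + T2 + T3 + T4 + T5 + T6 + T7 + T8) T9).trans (add_le_add a8 le_rfl)
      exact (abs_add_le _ T10).trans (add_le_add a9 le_rfl)
    -- x-side bounds
    have bA : (1 + x ^ 2) ^ 2 * |A| ≤ 4 * Md / L := weight_commutator_le hL hMd' hx1
    have bF2 : (1 + x ^ 2) ^ 2 * |F2| ≤ 4 * M2 * Real.exp (-L) := by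
      simpa using weight_farProfile_le (j := 0) hL (hM2 L hL) hx (by norm_num)
    have bxF3 : (1 + x ^ 2) ^ 2 * |x * F3| ≤ 4 * M3 * Real.exp (-L) := by
      have := weight_farProfile_le (j := 1) hL (hM3 L hL) hx (by norm_num); rw [abs_mul]; simpa [mul_assoc] using this
    have bF4 : (1 + x ^ 2) ^ 2 * |F4| ≤ 4 * M4 * Real.exp (-L) := by
      simpa using weight_farProfile_le (j := 0) hL (hM4 L hL) hx (by norm_num)
    have bF3 : (1 + x ^ 2) ^ 2 * |F3| ≤ 4 * M3 * Real.exp (-L) := by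
      simpa using weight_farProfile_le (j := 0) hL (hM3 L hL) hx (by norm_num)
    have bF1 : (1 + x ^ 2) ^ 2 * |F1| ≤ 4 * M1 * Real.exp (-L) := by
      simpa using weight_farProfile_le (j := 0) hL (hM1 L hL) hx (by norm_num)
    have bxF2 : (1 + x ^ 2) ^ 2 * |x * F2| ≤ 4 * M2 * Real.exp (-L) := by
      have := weight_farProfile_le (j := 1) hL (hM2 L hL) hx (by norm_num); rw [abs_mul]; simpa [mul_assoc] using this
    have bF0x : (1 + x ^ 2) ^ 2 * |F0 / x| ≤ 4 * M0 * Real.exp (-L) := by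
      -- `(1+x²)²|F₀|/|x| ≤ 4|x|³|F₀| ≤ 4M₀/|x| ≤ 4M₀e^{-L}`
      have hx0' : 0 < |x| := lt_of_lt_of_le one_pos hx1
      have hw := weight_le_four_pow hx1
      have hm := hM0 L hL x
      simp only [Nat.add_zero] at hm
      rw [abs_div]
      have hxinv : |x|⁻¹ ≤ Real.exp (-L) := by
        rw [Real.exp_neg]; exact inv_anti₀ (Real.exp_pos _) hx.le
      calc (1 + x ^ 2) ^ 2 * (|F0| / |x|) ≤ 4 * |x| ^ 4 * (|F0| / |x|) := by gcongr
        _ = 4 * (|x| ^ 4 * |F0|) * |x|⁻¹ := by ring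
        _ ≤ 4 * M0 * |x|⁻¹ := by gcongr
        _ ≤ 4 * M0 * Real.exp (-L) := by gcongr
    have bxF0g : (1 + x ^ 2) ^ 2 * |x * F0| * gaussE ((8/5 - 3/2 : ℝ) / 2) x ≤ 4 * M0 * CG * Real.exp (-L) := by
      have hx0' : 0 < |x| := lt_of_lt_of_le one_pos hx1
      have hw := weight_le_four_pow hx1
      have hm := hM0 L hL x
      simp only [Nat.add_zero] at hm
      have hg : |x| ^ 10 * gaussE ((8/5 - 3/2 : ℝ) / 2) x ≤ CG := by
        rw [show |x| ^ 10 = x ^ 10 by rw [show (10:ℕ) = 2 * 5 from rfl, pow_mul, sq_abs, ← pow_mul]]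
        exact pow_ten_mul_gaussE_le (by norm_num) x
      have hg0 : 0 < gaussE ((8/5 - 3/2 : ℝ) / 2) x := gaussE_pos _ _
      have hx9 : (|x| ^ 9)⁻¹ ≤ Real.exp (-L) := by
        refine le_trans (inv_anti₀ (pow_pos (Real.exp_pos _) _) (pow_le_pow_left₀ (Real.exp_pos _).le hx.le 9)) ?_
        exact inv_exp_mul_le hL0.le (by norm_num)
      rw [abs_mul]
      calc (1 + x ^ 2) ^ 2 * (|x| * |F0|) * gaussE ((8/5 - 3/2 : ℝ) / 2) x
          ≤ 4 * |x| ^ 4 * (|x| * |F0|) * gaussE ((8/5 - 3/2 : ℝ) / 2) x := by gcongr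
        _ = 4 * (|x| ^ 4 * |F0|) * ((|x| ^ 10 * gaussE ((8/5 - 3/2 : ℝ) / 2) x) * (|x| ^ 9)⁻¹) := by
            have h10 : |x| ^ 10 * (|x| ^ 9)⁻¹ = |x| := by
              rw [pow_succ, mul_comm (|x| ^ 9), mul_assoc, mul_inv_cancel₀ (pow_ne_zero 9 hx0'.ne'), mul_one]
            calc 4 * |x| ^ 4 * (|x| * |F0|) * gaussE ((8/5 - 3/2 : ℝ) / 2) x
                = 4 * (|x| ^ 4 * |F0|) * ((|x| ^ 10 * (|x| ^ 9)⁻¹) * gaussE ((8/5 - 3/2 : ℝ) / 2) x) := by rw [h10]; ring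
              _ = _ := by ring
        _ ≤ 4 * M0 * (CG * Real.exp (-L)) := by gcongr
        _ = 4 * M0 * CG * Real.exp (-L) := by ring
    -- coefficient bounds: `|cφ| ≤ Rc`, `|cφ x²| ≤ Rc`, `|(gam/2)ζ| ≤ Rc·…`
    obtain ⟨hcφ0, hcφRc⟩ := colCoeff_bounds hRc x v
    have bc : |cφ| ≤ Rc := by rw [hcφ, abs_of_nonneg hcφ0]; exact hcφRc
    have bcx : |(-(cφ * x ^ 2))| ≤ Rc := by
      rw [abs_neg, hcφ, abs_of_nonneg (by positivity)]; exact colCoeff_mul_sq_le hRc hx0 v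
    obtain ⟨hζc0, hζcRc, hζcg⟩ := zetaCoeff_bounds hRc x v
    have bζ : |(8/5 - 3/2 : ℝ) / 2 * ζ| ≤ Rc := by rw [hζ, abs_of_nonneg hζc0]; exact hζcRc
    -- y-side bounds via `wy_poly_le`, then each term
    have e1 := weight_prod_le (c := (-(1/5) : ℝ)) hwt hwx0 hwy0 bA (wy_poly_le (-lamW) 0 (lamW ^ 2) 0 v)
    have e2 := weight_prod_le (c := (1 : ℝ)) hwt hwx0 hwy0 bF2 (wy_poly_le ((8/5 - 3/2 : ℝ) - 2 * lamW) 0 (-(3/10) * lamW + 2 * lamW ^ 2) 0 v)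
    have e3 := weight_prod_le (c := (-(1/5) : ℝ)) hwt hwx0 hwy0 bxF3 (wy_poly_le 1 0 0 0 v)
    have e4 := weight_prod_le (c := (1 : ℝ)) hwt hwx0 hwy0 bF4 (wy_poly_le 1 0 0 0 v)
    have e5 := weight_prod_le (c := cφ) hwt hwx0 hwy0 bF3 (wy_poly_le 0 1 0 0 v)
    have e6 := weight_prod_le (c := cφ) hwt hwx0 hwy0 bF1 (wy_poly_le 0 (-lamW) 0 (lamW ^ 2) v)
    have e7 := weight_prod_le (c := -cφ) hwt hwx0 hwy0 bxF2 (wy_poly_le 0 (-lamW) 0 0 v)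
    have e8 := weight_prod_le (c := -(cφ * x ^ 2)) hwt hwx0 hwy0 bF0x (wy_poly_le 0 (3 * lamW ^ 2) 0 (-(lamW ^ 3)) v)
    have e10 := weight_prod_le (c := (8/5 - 3/2 : ℝ) / 2 * ζ) hwt hwx0 hwy0 bF1 (wy_poly_le 0 1 0 0 v)
    -- T9 by hand: |T9| = (gam/2) ζ |x F0| |p₁ E| ≤ Rc' gaussE(x) |xF0| |p1 E|
    have e9 : (1 + x ^ 2 + v ^ 2) ^ 2 * |T9| ≤ Rc * (4 * M0 * CG * Real.exp (-L)) * ((|(0:ℝ)| + |(-lamW)| + |(0:ℝ)| + |(0:ℝ)|) * CE) := by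
      have hy := wy_poly_le 0 (-lamW) 0 0 v
      have hcoef : |(-((8/5 - 3/2 : ℝ) / 2 * ζ))| ≤ Rc * gaussE ((8/5 - 3/2 : ℝ) / 2) x := by
        rw [abs_neg, hζ, abs_of_nonneg hζc0]; exact hζcg
      rw [hT9, abs_mul, abs_mul]
      have hY0 : 0 ≤ |(0 + -lamW * v + 0 * v ^ 2 + 0 * v ^ 3) * E| := abs_nonneg _
      calc (1 + x ^ 2 + v ^ 2) ^ 2 * (|(-((8/5 - 3/2 : ℝ) / 2 * ζ))| * |x * F0| * |(0 + -lamW * v + 0 * v ^ 2 + 0 * v ^ 3) * E|)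
          ≤ ((1 + x ^ 2) ^ 2 * (1 + v ^ 2) ^ 2) * ((Rc * gaussE ((8/5 - 3/2 : ℝ) / 2) x) * |x * F0| * |(0 + -lamW * v + 0 * v ^ 2 + 0 * v ^ 3) * E|) := by
            gcongr
        _ = Rc * ((1 + x ^ 2) ^ 2 * |x * F0| * gaussE ((8/5 - 3/2 : ℝ) / 2) x) * ((1 + v ^ 2) ^ 2 * |(0 + -lamW * v + 0 * v ^ 2 + 0 * v ^ 3) * E|) := by ring
        _ ≤ Rc * (4 * M0 * CG * Real.exp (-L)) * ((|(0:ℝ)| + |(-lamW)| + |(0:ℝ)| + |(0:ℝ)|) * CE) := by gcongr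
    -- assemble: replace `e^{-L}` by `1/L` and the variable coefficients by `Rc`
    apply hKdiv
    have hL1 : 0 ≤ 1 / L := by positivity
    have hP : ∀ (a₀ a₁ a₂ a₃ : ℝ), 0 ≤ (|a₀| + |a₁| + |a₂| + |a₃|) * CE := fun _ _ _ _ => by positivity
    set P1 := (|(-lamW)| + |(0:ℝ)| + |lamW ^ 2| + |(0:ℝ)|) * CE with hP1
    set P2 := (|(8/5 - 3/2 : ℝ) - 2 * lamW| + |(0:ℝ)| + |(-(3/10) * lamW + 2 * lamW ^ 2)| + |(0:ℝ)|) * CE with hP2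
    set P3 := (|(1:ℝ)| + |(0:ℝ)| + |(0:ℝ)| + |(0:ℝ)|) * CE with hP3
    set P5 := (|(0:ℝ)| + |(1:ℝ)| + |(0:ℝ)| + |(0:ℝ)|) * CE with hP5
    set P6 := (|(0:ℝ)| + |(-lamW)| + |(0:ℝ)| + |lamW ^ 2|) * CE with hP6
    set P7 := (|(0:ℝ)| + |(-lamW)| + |(0:ℝ)| + |(0:ℝ)|) * CE with hP7
    set P8 := (|(0:ℝ)| + |(3 * lamW ^ 2)| + |(0:ℝ)| + |(-(lamW ^ 3))|) * CE with hP8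
    have hP1p : 0 ≤ P1 := hP _ _ _ _
    have hP2p : 0 ≤ P2 := hP _ _ _ _
    have hP3p : 0 ≤ P3 := hP _ _ _ _
    have hP5p : 0 ≤ P5 := hP _ _ _ _
    have hP6p : 0 ≤ P6 := hP _ _ _ _
    have hP7p : 0 ≤ P7 := hP _ _ _ _
    have hP8p : 0 ≤ P8 := hP _ _ _ _
    set eL := Real.exp (-L) with heLdef
    -- generic step: `c·(b·eL)·P ≤ C·(b·(1/L))·P` for `|c| ≤ C`, `b, P ≥ 0`
    have step : ∀ {c C b P : ℝ}, |c| ≤ C → 0 ≤ b → 0 ≤ P → |c| * (b * eL) * P ≤ C * b * P * (1 / L) :=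
      fun {c C b P} hc hb hP => by
        have hC : 0 ≤ C := le_trans (abs_nonneg _) hc
        calc |c| * (b * eL) * P ≤ C * (b * eL) * P := by
              apply mul_le_mul_of_nonneg_right (mul_le_mul_of_nonneg_right hc (by positivity)) hP
          _ ≤ C * (b * (1 / L)) * P := by
              apply mul_le_mul_of_nonneg_right (mul_le_mul_of_nonneg_left (mul_le_mul_of_nonneg_left heL hb) hC) hP
          _ = C * b * P * (1 / L) := by ring
    have h15 : |(-(1/5) : ℝ)| ≤ 1/5 := by norm_num
    have h11 : |(1 : ℝ)| ≤ 1 := by norm_num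
    have f1 : (1 + x ^ 2 + v ^ 2) ^ 2 * |T1| ≤ (1/5) * (4 * Md) * P1 * (1 / L) := by
      refine e1.trans ?_
      calc |(-(1/5) : ℝ)| * (4 * Md / L) * P1 ≤ (1/5) * (4 * Md / L) * P1 :=
            mul_le_mul_of_nonneg_right (mul_le_mul_of_nonneg_right h15 (by positivity)) hP1p
        _ = (1/5) * (4 * Md) * P1 * (1 / L) := by ring
    have f2 : (1 + x ^ 2 + v ^ 2) ^ 2 * |T2| ≤ 1 * (4 * M2) * P2 * (1 / L) := by
      refine e2.trans ?_
      have hb : 0 ≤ 4 * M2 := by positivity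
      calc |(1:ℝ)| * (4 * M2 * eL) * P2 ≤ 1 * (4 * M2 * eL) * P2 :=
            mul_le_mul_of_nonneg_right (mul_le_mul_of_nonneg_right h11 (mul_nonneg hb (Real.exp_pos _).le)) hP2p
        _ ≤ 1 * (4 * M2 * (1 / L)) * P2 :=
            mul_le_mul_of_nonneg_right (mul_le_mul_of_nonneg_left (mul_le_mul_of_nonneg_left heL hb) zero_le_one) hP2p
        _ = 1 * (4 * M2) * P2 * (1 / L) := by ring
    have f3 : (1 + x ^ 2 + v ^ 2) ^ 2 * |T3| ≤ (1/5) * (4 * M3) * P3 * (1 / L) := e3.trans (step h15 (by positivity) hP3p)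
    have f4 : (1 + x ^ 2 + v ^ 2) ^ 2 * |T4| ≤ 1 * (4 * M4) * P3 * (1 / L) := e4.trans (step h11 (by positivity) hP3p)
    have f5 : (1 + x ^ 2 + v ^ 2) ^ 2 * |T5| ≤ Rc * (4 * M3) * P5 * (1 / L) := e5.trans (step bc (by positivity) hP5p)
    have f6 : (1 + x ^ 2 + v ^ 2) ^ 2 * |T6| ≤ Rc * (4 * M1) * P6 * (1 / L) := e6.trans (step bc (by positivity) hP6p)
    have bc' : |(-cφ)| ≤ Rc := by rw [abs_neg]; exact bc
    have f7 : (1 + x ^ 2 + v ^ 2) ^ 2 * |T7| ≤ Rc * (4 * M2) * P7 * (1 / L) := e7.trans (step bc' (by positivity) hP7p)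
    have f8 : (1 + x ^ 2 + v ^ 2) ^ 2 * |T8| ≤ Rc * (4 * M0) * P8 * (1 / L) := e8.trans (step bcx (by positivity) hP8p)
    have f9 : (1 + x ^ 2 + v ^ 2) ^ 2 * |T9| ≤ Rc * (4 * M0 * CG) * P7 * (1 / L) := by
      refine e9.trans ?_
      calc Rc * (4 * M0 * CG * eL) * P7 ≤ Rc * (4 * M0 * CG * (1 / L)) * P7 :=
            mul_le_mul_of_nonneg_right (mul_le_mul_of_nonneg_left (mul_le_mul_of_nonneg_left heL (by positivity)) hRc) hP7p
        _ = Rc * (4 * M0 * CG) * P7 * (1 / L) := by ring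
    have f10 : (1 + x ^ 2 + v ^ 2) ^ 2 * |T10| ≤ Rc * (4 * M1) * P5 * (1 / L) := e10.trans (step bζ (by positivity) hP5p)
    have hwtpos : 0 ≤ (1 + x ^ 2 + v ^ 2) ^ 2 := by positivity
    calc (1 + x ^ 2 + v ^ 2) ^ 2 * |T1 + T2 + T3 + T4 + T5 + T6 + T7 + T8 + T9 + T10|
        ≤ (1 + x ^ 2 + v ^ 2) ^ 2 * (|T1| + |T2| + |T3| + |T4| + |T5| + |T6| + |T7| + |T8| + |T9| + |T10|) :=
          mul_le_mul_of_nonneg_left htri hwtpos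
      _ = (1 + x ^ 2 + v ^ 2) ^ 2 * |T1| + (1 + x ^ 2 + v ^ 2) ^ 2 * |T2| + (1 + x ^ 2 + v ^ 2) ^ 2 * |T3| + (1 + x ^ 2 + v ^ 2) ^ 2 * |T4|
          + (1 + x ^ 2 + v ^ 2) ^ 2 * |T5| + (1 + x ^ 2 + v ^ 2) ^ 2 * |T6| + (1 + x ^ 2 + v ^ 2) ^ 2 * |T7| + (1 + x ^ 2 + v ^ 2) ^ 2 * |T8|
          + (1 + x ^ 2 + v ^ 2) ^ 2 * |T9| + (1 + x ^ 2 + v ^ 2) ^ 2 * |T10| := by ring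
      _ ≤ ((1/5) * (4 * Md) * P1 + 1 * (4 * M2) * P2 + (1/5) * (4 * M3) * P3 + 1 * (4 * M4) * P3 + Rc * (4 * M3) * P5 + Rc * (4 * M1) * P6
          + Rc * (4 * M2) * P7 + Rc * (4 * M0) * P8 + Rc * (4 * M0 * CG) * P7 + Rc * (4 * M1) * P5) * (1 / L) := by
          linarith [f1, f2, f3, f4, f5, f6, f7, f8, f9, f10]
      _ = _ := by rw [hP1, hP2, hP3, hP5, hP6, hP7, hP8]; ring

end Summit.NavierStokesRegularity.NavierStokesRegularity.Theorems.DefectColumnGate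

end
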